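import Literature.MathematicalPhysics.QuantumLattice.SpinChains
import HarnessLib

/-!
# Discharge for `SpinChains`: the open AKLT chain is the AKLT Hamiltonian on the path graph

Sibling proof file of `Literature/MathematicalPhysics/QuantumLattice/SpinChains.lean`: it discharges
the named fact `akltOpenChain_eq_akltHamiltonian_pathGraph` (`def … : Prop`, D-0014) of that file as
`theorem akltOpenChain_eq_akltHamiltonian_pathGraph_holds`, from Mathlib and the API of
`HeisenbergModel` / `SpinChains`. No statement of `SpinChains` is changed and no definition is
introduced.

The identity proved is the bookkeeping statement that the open AKLT chain
`akltOpenChain L = Σ_{i=0}^{L-2} h_{i,i+1}`, `h_{xy} = 𝐒_x · 𝐒_y + ⅓ (𝐒_x · 𝐒_y)²` (AKLT (1988)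
eq. (1.1) and §2.1, eq. (2.2): `H = Σ_i H_i` on the finite chain `{1, …, L}` with free ends;
Tasaki (2020) §7.1), written in `SpinChains` as the constrained double sum
`Σ_i Σ_j [i + 1 = j] h_{ij}` over `Fin L`, equals the graph AKLT Hamiltonian
`akltHamiltonian (pathGraph L) = Σ_{{x,y} ∈ E(pathGraph L)} (1 · 𝐒_x · 𝐒_y + ⅓ (𝐒_x · 𝐒_y)²)` of
`HeisenbergModel` on Mathlib's path graph (`SimpleGraph.pathGraph_adj`: `x ~ y ↔ x + 1 = y ∨
y + 1 = x`). Ingredients, all elementary: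

* for `L = k + 1` the edges of `pathGraph (k + 1)` are exactly the `k` distinct pairs
  `{i.castSucc, i.succ}`, `i : Fin k` (`pathBond_mem_edgeFinset_pathGraph`, `pathBond_injective`,
  `exists_pathBond_of_mem_edgeFinset_pathGraph`), so an edge sum is reordered along this bijection
  with `Finset.sum_nbij` (`sum_edgeFinset_pathGraph_succ`);
* the constrained double sum `Σ_i Σ_j [i + 1 = j] g i j` over `Fin (k + 1)` collapses to
  `Σ_{i : Fin k} g i.castSucc i.succ` (`sum_sum_ite_val_succ`): the row of the last site is empty
  and every other row has the single term `j = i.succ`;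
* for `L = 0` both sides are empty sums;
* the casts `((1 : ℝ) : ℂ) = 1`, `((1/3 : ℝ) : ℂ) = 1/3` identify the bilinear-biquadratic bond term
  with `J = 1`, `K = 1/3` with `akltBond` (`ofReal_smul_spinDot_add_eq_akltBond`).

## Sources

* I. Affleck, T. Kennedy, E. H. Lieb, H. Tasaki, *Valence bond ground states in isotropic quantum
  antiferromagnets*, Comm. Math. Phys. 115 (1988) 477–528: eq. (1.1) (p. 478) and §2.1, eq. (2.2)
  (p. 481), the finite chain `{1, …, L}` with open boundary conditions (§2.1, Remark 1, p. 484).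
  [AKLT1988]
* H. Tasaki, *Physics and Mathematics of Quantum Many-Body Systems* (Springer, 2020), §7.1 (the
  AKLT model). [Tasaki2020]

## Mathlib / Literature status

Uses `SimpleGraph.pathGraph_adj`, `SimpleGraph.mem_edgeFinset`, `Finset.sum_nbij`, `Sym2.eq_iff`,
`Sym2.eq_swap`, `Sym2.lift_mk`, `Fin.sum_univ_castSucc`, `Finset.sum_eq_single_of_mem` from
Mathlib; `spinDot`, `biquadraticHamiltonian`, `akltHamiltonian` (`HeisenbergModel`), `akltBond`,
`akltOpenChain` (`SpinChains`). Nothing else of `SpinChains` is touched.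
-/

noncomputable section

open Matrix Complex SimpleGraph

namespace Literature.MathematicalPhysics.QuantumLattice

section PathGraphEdges

/-! ### The edges of the path graph are the bonds `{i, i+1}` -/

/-- Consecutive sites are adjacent in the path graph: `{i, i+1} ∈ E(pathGraph (k+1))` for
`i : Fin k` (as `{i.castSucc, i.succ}`). [folklore] -/
theorem pathBond_mem_edgeFinset_pathGraph {k : ℕ} [DecidableRel (pathGraph (k + 1)).Adj]
    (i : Fin k) : s(i.castSucc, i.succ) ∈ (pathGraph (k + 1)).edgeFinset := by
  rw [mem_edgeFinset, mem_edgeSet, pathGraph_adj]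
  exact Or.inl (by rw [Fin.val_castSucc, Fin.val_succ])

/-- `i ↦ {i, i+1}` is injective on `Fin k`: `{i, i+1} = {j+1, j}` would force `i = j + 1` and
`i + 1 = j` in `ℕ`. [folklore] -/
theorem pathBond_injective (k : ℕ) :
    Function.Injective fun i : Fin k => s(i.castSucc, i.succ) := by
  intro i j hij
  rcases Sym2.eq_iff.1 hij with ⟨h, -⟩ | ⟨h, h'⟩
  · exact Fin.castSucc_injective _ h
  · have h1 := congrArg Fin.val h
    have h2 := congrArg Fin.val h'
    rw [Fin.val_castSucc, Fin.val_succ] at h1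
    rw [Fin.val_succ, Fin.val_castSucc] at h2
    exact absurd h2 (by omega)

/-- Every edge `{x, y}` of the path graph on `k + 1` vertices is a bond `{i, i+1}`, `i : Fin k`
(namely `i = x` if `x + 1 = y` and `i = y` if `y + 1 = x`). [folklore] -/
theorem exists_pathBond_of_mem_edgeFinset_pathGraph {k : ℕ} [DecidableRel (pathGraph (k + 1)).Adj]
    {b : Sym2 (Fin (k + 1))} (hb : b ∈ (pathGraph (k + 1)).edgeFinset) :
    ∃ i : Fin k, s(i.castSucc, i.succ) = b := by
  revert hb
  refine Sym2.ind (fun x y hxy => ?_) b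
  rw [mem_edgeFinset, mem_edgeSet, pathGraph_adj] at hxy
  have hx := x.isLt
  have hy := y.isLt
  rcases hxy with h | h
  · refine ⟨⟨x.val, by omega⟩, Sym2.eq_iff.2 (Or.inl ⟨Fin.ext rfl, Fin.ext ?_⟩)⟩
    rw [Fin.val_succ]
    exact h
  · refine ⟨⟨y.val, by omega⟩, Sym2.eq_iff.2 (Or.inr ⟨Fin.ext rfl, Fin.ext ?_⟩)⟩
    rw [Fin.val_succ]
    exact h

/-- An edge sum over the path graph on `k + 1` vertices is the sum over the `k` bonds
`{i, i+1}`, `i : Fin k` (reordering along the bijection `i ↦ {i, i+1}`, `Finset.sum_nbij`).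
[folklore] -/
theorem sum_edgeFinset_pathGraph_succ {α : Type*} [AddCommMonoid α] {k : ℕ}
    [DecidableRel (pathGraph (k + 1)).Adj] (F : Sym2 (Fin (k + 1)) → α) :
    ∑ e ∈ (pathGraph (k + 1)).edgeFinset, F e = ∑ i : Fin k, F s(i.castSucc, i.succ) := by
  symm
  refine Finset.sum_nbij (fun i : Fin k => s(i.castSucc, i.succ))
    (fun i _ => pathBond_mem_edgeFinset_pathGraph i) ?_ ?_ ?_
  · exact fun i _ j _ hij => pathBond_injective k hij
  · intro b hb
    obtain ⟨i, rfl⟩ := exists_pathBond_of_mem_edgeFinset_pathGraph (Finset.mem_coe.1 hb)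
    exact ⟨i, Finset.mem_coe.2 (Finset.mem_univ i), rfl⟩
  · exact fun i _ => rfl

/-- The constrained double sum `Σ_i Σ_j [i + 1 = j] g i j` over `Fin (k + 1)` (the "open chain"
bookkeeping of `heisenbergOpenChain` / `akltOpenChain`) is the bond sum `Σ_{i : Fin k} g i (i+1)`:
the row of the last site is empty and every other row has the single term `j = i + 1`.
[folklore] -/
theorem sum_sum_ite_val_succ {α : Type*} [AddCommMonoid α] {k : ℕ}
    (g : Fin (k + 1) → Fin (k + 1) → α) :
    (∑ i : Fin (k + 1), ∑ j : Fin (k + 1), if i.val + 1 = j.val then g i j else 0) =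
      ∑ i : Fin k, g i.castSucc i.succ := by
  rw [Fin.sum_univ_castSucc]
  have hlast :
      (∑ j : Fin (k + 1), if (Fin.last k).val + 1 = j.val then g (Fin.last k) j else 0) = 0 :=
    Finset.sum_eq_zero fun j _ => if_neg (by rw [Fin.val_last]; have := j.isLt; omega)
  rw [hlast, add_zero]
  refine Finset.sum_congr rfl fun i _ => ?_
  rw [Finset.sum_eq_single_of_mem i.succ (Finset.mem_univ _)]
  · rw [if_pos (by rw [Fin.val_castSucc, Fin.val_succ])]
  · intro j _ hj
    exact if_neg fun h => hj (Fin.ext (by rw [Fin.val_succ, ← h, Fin.val_castSucc]))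

end PathGraphEdges

section AKLT

variable {Λ : Type*} [Fintype Λ] [DecidableEq Λ]

/-- The bilinear-biquadratic bond term `J 𝐒_x · 𝐒_y + K (𝐒_x · 𝐒_y)²` of `biquadraticHamiltonian`
at `J = 1`, `K = 1/3` (real couplings cast to `ℂ`) is the AKLT bond term `akltBond x y`.
AKLT (1988) eq. (1.1); Tasaki (2020) §7.1. [cite: AKLT1988, eq. (1.1)] -/
theorem ofReal_smul_spinDot_add_eq_akltBond (x y : Λ) :
    ((1 : ℝ) : ℂ) • spinDot 2 x y + ((1 / 3 : ℝ) : ℂ) • (spinDot 2 x y * spinDot 2 x y) =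
      akltBond x y := by
  rw [Complex.ofReal_one, one_smul, Complex.ofReal_div, Complex.ofReal_one, Complex.ofReal_ofNat]
  rfl

/-! ### Discharge -/

/-- **Discharge of `akltOpenChain_eq_akltHamiltonian_pathGraph`.** The open AKLT chain
`Σ_{i=0}^{L-2} (𝐒_i · 𝐒_{i+1} + ⅓ (𝐒_i · 𝐒_{i+1})²)` on `Fin L` (AKLT (1988) eq. (1.1) and §2.1,
eq. (2.2), the finite chain with free ends; Tasaki (2020) §7.1) is the graph AKLT Hamiltonian
`akltHamiltonian (pathGraph L) = Σ_{{x,y} ∈ E(pathGraph L)} (𝐒_x · 𝐒_y + ⅓ (𝐒_x · 𝐒_y)²)` on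
Mathlib's path graph, for every `L` and every decidability instance of its adjacency: for `L = 0`
both sides are empty sums; for `L = k + 1` reorder the edge sum along `i ↦ {i, i+1}`
(`sum_edgeFinset_pathGraph_succ`), collapse the constrained double sum (`sum_sum_ite_val_succ`)
and identify the bond terms (`ofReal_smul_spinDot_add_eq_akltBond`).
[cite: AKLT1988, §2.1, eq. (2.2)] -/
theorem akltOpenChain_eq_akltHamiltonian_pathGraph_holds :
    akltOpenChain_eq_akltHamiltonian_pathGraph := by
  intro L _
  unfold akltOpenChain akltHamiltonian biquadraticHamiltonian
  cases L with
  | zero =>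
    rw [Finset.eq_empty_of_isEmpty (pathGraph 0).edgeFinset, Finset.sum_empty]
    exact Finset.sum_eq_zero fun i _ => i.elim0
  | succ k =>
    rw [sum_edgeFinset_pathGraph_succ, sum_sum_ite_val_succ]
    refine Finset.sum_congr rfl fun i _ => ?_
    rw [Sym2.lift_mk]
    exact (ofReal_smul_spinDot_add_eq_akltBond _ _).symm

end AKLT

end Literature.MathematicalPhysics.QuantumLattice
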